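import Mathlib.Algebra.BigOperators.Field
import Mathlib.Analysis.SpecialFunctions.Pow.Real
import Mathlib.Combinatorics.SimpleGraph.Metric
import HarnessLib

/-!
# The Cheeger–Kleiner–Naor compression bound: `L¹`-distortion of word balls of the discrete
Heisenberg group (named fact) and its box form

Family `pnp`, layer `Literature/Geometry/MetricEmbeddings`. Consumer: the route
`Summits/PneNP/PneNP/Theses/HeisenbergSparsestCut` (support `HeisenbergGivesLasserreGaps`, crux
`HeisenbergBoxesAreLasserreMetrics`), whose inlined hypothesis is exactly the conclusion of
`CheegerKleinerNaor2011_wordBall_l1Distortion.box` below. Sources read, verbatim: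

* J. Cheeger, B. Kleiner, A. Naor, *Compression bounds for Lipschitz maps from the Heisenberg
  group to `L₁`*, Acta Math. 207 (2011) 291–373 = arXiv:0910.2026, §1.1 (arXiv pp. 4–5):
  "We will view `ℍ` as `ℝ³` equipped with the noncommutative product
  `(a,b,c)·(a',b',c') = (a+a', b+b', c+c'+ab'−ba')` […] The discrete Heisenberg group, `ℍ(ℤ)`, is
  the integer lattice `ℤ³` […] equipped with the above product. It is a discrete cocompact subgroup
  of `ℍ`. […] The word metric, `d_T` on `Γ` is the left invariant metric defined by stipulating that
  `d_T(g₁,g₂)` is the length of the shortest word in the elements of `T` and their inverses which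
  expresses `g₁⁻¹g₂`. Up to bi-Lipschitz equivalence, the metric `d_T` is independent of the choice
  of generating set. […] By an easy general lemma, given a free co-compact action of a finitely
  generated group `Γ` […] on a length space `(X,d^X)`, the metric on `Γ` induced by the restriction
  to any orbit of the metric `d^X` is bi-Lipschitz equivalent to `d_T`; see [BBI]. For the case of
  `ℍ(ℤ)`, we can take `(X,d^X) = (ℍ,d^ℍ)`. […] It was shown in [LN06] that `(ℍ,ρ)` is a metric of
  negative type bi-Lipschitz to `(ℍ,d^ℍ)`." — **Theorem 1.1 (Quantitative central collapse).**
  "There exists a universal constant `δ ∈ (0,1)` such that for every `p ∈ ℍ`, every `f : B₁(p) → L₁`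
  with `Lip(f) ≤ 1`, and every `ε ∈ (0,1/4)`, there exists `r ≥ ε` such that […] at least half of
  the points `(x₁,x₂) ∈ B_r(x) × B_r(x)` which lie on the same coset of the center satisfy
  `‖f(x₁) − f(x₂)‖_{L₁} / d^ℍ(x₁,x₂) ≤ 1/(log(1/ε))^δ`." — **Corollary (1.2).** "For the constant
  `δ > 0` in Theorem 1.1, we have for all `n ∈ ℕ`, metric spaces `({0,…,n}³, ρ)` of negative type,
  satisfying `c₁({0,…,n}³, ρ) ≳ (log n)^δ`."
* A. Naor, R. Young, *Vertical perimeter versus horizontal perimeter*, Ann. of Math. 188 (2018)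
  = arXiv:1701.00620, §1.2 (arXiv p. 6): "the `L_p` (bi-Lipschitz) distortion of a separable
  metric space `(𝓜,d)`, denoted `c_p(𝓜,d)`, is the infimum over those `D ∈ [1,∞]` for which there
  exists an embedding `f : 𝓜 → L_p(ℝ)` such that `d(x,y) ≤ ‖f(x)−f(y)‖ ≤ D d(x,y)` for every
  `x, y ∈ 𝓜`. […] The previously best known estimate [CKN] was that there exists a universal
  constant `δ > 0` such that `c₁(𝔅_r, d_W) ≥ (log r)^δ`" (word-metric balls `𝔅_r`; Naor–Young
  prove the sharp `c₁(𝔅_r, d_W) ≍ √(log r)` for the balls of the five-dimensional group `ℍ⁵_ℤ`,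
  Thm. 1.6 of the arXiv numbering — not vendored here).

## The statement on concrete carriers

* `ℍ(ℤ)` is taken in its standard upper-triangular model on `ℤ × ℤ × ℤ`,
  `(x,y,z)·(x',y',z') = (x+x', y+y', z+z'+xy')` (`heisMul`; the map `(x,y,z) ↦ (x, y, 2z − xy)` is
  an isomorphism onto the index-`2` subgroup `{c ≡ ab mod 2}` of the lattice of [CKN §1.1], so both
  are cocompact lattices of `ℍ` and the quoted bi-Lipschitz lemma [BBI] applies to either), with
  right generators `a = (1,0,0)`, `b = (0,1,0)`: the Cayley graph `cayleyGraph` (adjacency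
  `g ~ g·a`, `g ~ g·b`, symmetrised — syntactically the `SimpleGraph.fromRel` term inlined in the
  route), the word metric `d_W = cayleyGraph.dist`, and the word ball
  `wordBall r = {g | some walk from (0,0,0) to g has length ≤ r}` (= words of length `≤ r` in
  `a^{±1}, b^{±1}`; defined through walks, not through `dist`, so that no connectivity lemma is
  needed to control it).
* `L₁` targets are replaced by the finite-dimensional `ℓ₁^N = (Fin N → ℝ, Σ_k |·|)` for all `N`:
  every `ℓ₁^N` embeds isometrically in `L₁(ℝ)`, so "every embedding into `L₁` has distortion
  `≥ κ (log r)^δ`" IMPLIES the vendored "every embedding into some `ℓ₁^N` has distortion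
  `≥ κ (log r)^δ`" (for finite metric spaces the two are equivalent by the cut-cone / Carathéodory
  argument, but only the weaker direction is asserted).
* The named fact `CheegerKleinerNaor2011_wordBall_l1Distortion`: there are universal `δ > 0` and
  `κ > 0` (the constant implicit in "`≳`") such that for every `r ≥ 2`, every `N` and every
  `f : ℤ³ → ℓ₁^N` with `d_W(g,h) ≤ ‖f g − f h‖₁ ≤ D·d_W(g,h)` for all `g, h ∈ wordBall r`, one has
  `κ (log r)^δ ≤ D`. This is Corollary 1.2 transported along the bi-Lipschitz identifications
  PRINTED in [CKN §1.1] (`ρ ≍ d^ℍ ≍ d_T` with universal constants; `{0,…,n}³ ⊆` a word ball of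
  radius `≍ n`, and `c₁` is monotone under inclusion), i.e. the form "`c₁(𝔅_r, d_W) ≥ (log r)^δ`
  [CKN]" quoted from Naor–Young.

PROVED here: `mem_wordBall_bounds` (a word of length `≤ r` has `|x|, |y| ≤ r` and `|z| ≤ r²`:
the ball lies in the box `B_r = [-r,r]² × [-r²,r²]`), `dist_zero_a` (`d_W(1, a) = 1`), and the
**box form** `CheegerKleinerNaor2011_wordBall_l1Distortion.box` — from the fact, the EXACT inlined
hypothesis of `HeisenbergGivesLasserreGaps`: `∃ c > 0, ∀ n ≥ 2, ∀ N f s D, 0 < s →`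
(two-sided bounds `s·d_W ≤ ‖f g − f h‖₁ ≤ D·s·d_W` on the box `|x|,|y| ≤ n, |z| ≤ n²`)
`→ c·(log n)^c ≤ D` (restrict to the ball, rescale by `s`, and absorb constants:
`c = min (min δ κ) (1/2)`, using `D ≥ 1` from the pair `1, a`).

Not here: the discharge (XL: quantitative differentiation / monotone sets in `ℍ`), Lee–Naor's
negative-type metric `ρ`, the sharp Naor–Young bound, the Linial–London–Rabinovich / Aumann–Rabani
gap–distortion duality, and a `Group` instance for `ℍ(ℤ)` (only `heisMul` and its relation to the
Cayley graph are recorded).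

## References

* [CheegerKleinerNaor2011] J. Cheeger, B. Kleiner, A. Naor, Acta Math. 207 (2011) 291–373, §1.1:
  Thm. 1.1 and Cor. 1.2 (arXiv:0910.2026 pp. 4–5).
* [NaorYoung2018] A. Naor, R. Young, Ann. of Math. 188 (2018), §1.2 (arXiv:1701.00620 p. 6).
-/

noncomputable section

open Finset

namespace Literature.Geometry.MetricEmbeddings

/-! ### The discrete Heisenberg group `ℍ(ℤ)` on `ℤ × ℤ × ℤ` and its Cayley graph -/

/-- The product of the discrete Heisenberg group `ℍ(ℤ)` in the upper-triangular model on
`ℤ × ℤ × ℤ`: `(x,y,z)·(x',y',z') = (x+x', y+y', z+z'+xy')` (the matrices `[[1,x,z],[0,1,y],[0,0,1]]`;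
isomorphic to an index-`2` sublattice of the model `c+c'+ab'−ba'` of [CKN §1.1]).
[cite: CheegerKleinerNaor2011, §1.1] -/
def heisMul (g h : ℤ × ℤ × ℤ) : ℤ × ℤ × ℤ :=
  (g.1 + h.1, g.2.1 + h.2.1, g.2.2 + h.2.2 + g.1 * h.2.1)

/-- The generator `a = (1,0,0)` of `ℍ(ℤ)`. [cite: CheegerKleinerNaor2011, §1.1] -/
def genA : ℤ × ℤ × ℤ := (1, 0, 0)

/-- The generator `b = (0,1,0)` of `ℍ(ℤ)`. [cite: CheegerKleinerNaor2011, §1.1] -/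
def genB : ℤ × ℤ × ℤ := (0, 1, 0)

/-- Right multiplication by `a`: `(x,y,z)·a = (x+1, y, z)`. [cite: CheegerKleinerNaor2011, §1.1] -/
@[simp]
theorem heisMul_genA (g : ℤ × ℤ × ℤ) : heisMul g genA = (g.1 + 1, g.2.1, g.2.2) := by
  simp [heisMul, genA]

/-- Right multiplication by `b`: `(x,y,z)·b = (x, y+1, z+x)`. [cite: CheegerKleinerNaor2011, §1.1] -/
@[simp]
theorem heisMul_genB (g : ℤ × ℤ × ℤ) : heisMul g genB = (g.1, g.2.1 + 1, g.2.2 + g.1) := by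
  simp [heisMul, genB]

/-- The **Cayley graph** of `ℍ(ℤ)` for the right generators `a, b` (edges `g ~ g·a`, `g ~ g·b`,
symmetrised by `SimpleGraph.fromRel`); written out in coordinates so that it is SYNTACTICALLY the
graph inlined in the route `HeisenbergSparsestCut`. Its graph distance is the word metric `d_W`.
[cite: CheegerKleinerNaor2011, §1.1] -/
def cayleyGraph : SimpleGraph (ℤ × ℤ × ℤ) :=
  SimpleGraph.fromRel fun a b : ℤ × ℤ × ℤ =>
    b = (a.1 + 1, a.2.1, a.2.2) ∨ b = (a.1, a.2.1 + 1, a.2.2 + a.1)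

/-- The defining relation of `cayleyGraph` is right multiplication by a generator.
[cite: CheegerKleinerNaor2011, §1.1] -/
theorem cayleyGraph_rel_iff (g h : ℤ × ℤ × ℤ) :
    (h = (g.1 + 1, g.2.1, g.2.2) ∨ h = (g.1, g.2.1 + 1, g.2.2 + g.1)) ↔
      (h = heisMul g genA ∨ h = heisMul g genB) := by
  rw [heisMul_genA, heisMul_genB]

/-- Adjacency in the Cayley graph: `g ~ h` iff `g ≠ h` and one is obtained from the other by right
multiplication by `a` or `b`. [cite: CheegerKleinerNaor2011, §1.1] -/
theorem cayleyGraph_adj (g h : ℤ × ℤ × ℤ) :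
    cayleyGraph.Adj g h ↔ g ≠ h ∧
      ((h = (g.1 + 1, g.2.1, g.2.2) ∨ h = (g.1, g.2.1 + 1, g.2.2 + g.1)) ∨
        (g = (h.1 + 1, h.2.1, h.2.2) ∨ g = (h.1, h.2.1 + 1, h.2.2 + h.1))) := by
  simp [cayleyGraph, SimpleGraph.fromRel_adj]

/-- `1 = (0,0,0)` and `a = (1,0,0)` are adjacent. [cite: CheegerKleinerNaor2011, §1.1] -/
theorem cayleyGraph_adj_zero_genA : cayleyGraph.Adj (0, 0, 0) (1, 0, 0) := by
  rw [cayleyGraph_adj]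
  exact ⟨by decide, Or.inl (Or.inl rfl)⟩

/-- `d_W(1, a) = 1`. [cite: CheegerKleinerNaor2011, §1.1] -/
theorem dist_zero_genA : cayleyGraph.dist (0, 0, 0) (1, 0, 0) = 1 :=
  (SimpleGraph.dist_eq_one_iff_adj).mpr cayleyGraph_adj_zero_genA

/-- The **word ball** of radius `r` about the identity: the elements reachable from `(0,0,0)` by a
walk of length `≤ r` in the Cayley graph, i.e. expressible as a word of length `≤ r` in
`a^{±1}, b^{±1}` ("`𝔅_r = {h : d_W(h,1) ≤ r}`"). [cite: NaorYoung2018, §1.2] -/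
def wordBall (r : ℕ) : Set (ℤ × ℤ × ℤ) :=
  {g | ∃ p : cayleyGraph.Walk (0, 0, 0) g, p.length ≤ r}

/-- The identity lies in every word ball. [cite: NaorYoung2018, §1.2] -/
theorem zero_mem_wordBall (r : ℕ) : ((0, 0, 0) : ℤ × ℤ × ℤ) ∈ wordBall r :=
  ⟨SimpleGraph.Walk.nil, Nat.zero_le _⟩

/-- `a` lies in the word ball of every radius `r ≥ 1`. [cite: NaorYoung2018, §1.2] -/
theorem genA_mem_wordBall {r : ℕ} (hr : 1 ≤ r) : ((1, 0, 0) : ℤ × ℤ × ℤ) ∈ wordBall r :=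
  ⟨SimpleGraph.Walk.cons cayleyGraph_adj_zero_genA SimpleGraph.Walk.nil, by simpa using hr⟩

/-- Coordinates along a walk ending at the identity: a walk of length `L` from `g` to `(0,0,0)`
forces `|x| ≤ L`, `|y| ≤ L`, `|z| ≤ L²` (each step changes `x` or `y` by `±1`, and `z` by at most
`|x|`). [cite: CheegerKleinerNaor2011, §1.1] -/
theorem walk_to_zero_bounds {g : ℤ × ℤ × ℤ} (p : cayleyGraph.Walk g (0, 0, 0)) :
    |g.1| ≤ p.length ∧ |g.2.1| ≤ p.length ∧ |g.2.2| ≤ (p.length : ℤ) ^ 2 := by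
  suffices h : ∀ (u v : ℤ × ℤ × ℤ) (q : cayleyGraph.Walk u v), v = (0, 0, 0) →
      |u.1| ≤ q.length ∧ |u.2.1| ≤ q.length ∧ |u.2.2| ≤ (q.length : ℤ) ^ 2 from h _ _ p rfl
  intro u v q
  induction q with
  | nil =>
    rintro rfl
    simp
  | @cons u w v hadj q ih =>
    rintro rfl
    obtain ⟨h1, h2, h3⟩ := ih rfl
    obtain ⟨x, y, z⟩ := u
    obtain ⟨x', y', z'⟩ := w
    simp only [SimpleGraph.Walk.length_cons, Nat.cast_add, Nat.cast_one]
    rw [cayleyGraph_adj] at hadj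
    obtain ⟨-, hrel⟩ := hadj
    simp only [Prod.mk.injEq] at hrel
    set L : ℤ := (q.length : ℤ) with hL
    have hL0 : 0 ≤ L := by positivity
    have hsq : (L + 1) ^ 2 = L ^ 2 + 2 * L + 1 := by ring
    rw [abs_le] at h1 h2 h3 ⊢
    rw [abs_le, abs_le]
    simp only at h1 h2 h3 ⊢
    rcases hrel with (⟨rfl, rfl, rfl⟩ | ⟨rfl, rfl, rfl⟩) | (⟨rfl, rfl, rfl⟩ | ⟨rfl, rfl, rfl⟩)
    · exact ⟨⟨by linarith, by linarith⟩, ⟨by linarith, by linarith⟩, by linarith, by linarith⟩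
    · exact ⟨⟨by linarith, by linarith⟩, ⟨by linarith, by linarith⟩, by nlinarith, by nlinarith⟩
    · exact ⟨⟨by linarith, by linarith⟩, ⟨by linarith, by linarith⟩, by linarith, by linarith⟩
    · exact ⟨⟨by linarith, by linarith⟩, ⟨by linarith, by linarith⟩, by nlinarith, by nlinarith⟩

/-- **The word ball lies in the box**: `g ∈ wordBall r` has `|x| ≤ r`, `|y| ≤ r`, `|z| ≤ r²`
(`𝔅_r ⊆ B_r = [-r,r]² × [-r²,r²]`). [cite: CheegerKleinerNaor2011, §1.1] -/
theorem mem_wordBall_bounds {r : ℕ} {g : ℤ × ℤ × ℤ} (hg : g ∈ wordBall r) :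
    |g.1| ≤ r ∧ |g.2.1| ≤ r ∧ |g.2.2| ≤ (r : ℤ) ^ 2 := by
  obtain ⟨p, hp⟩ := hg
  obtain ⟨h1, h2, h3⟩ := walk_to_zero_bounds p.reverse
  rw [SimpleGraph.Walk.length_reverse] at h1 h2 h3
  have hp' : (p.length : ℤ) ≤ r := by exact_mod_cast hp
  refine ⟨h1.trans hp', h2.trans hp', h3.trans ?_⟩
  have h0 : (0 : ℤ) ≤ p.length := by positivity
  nlinarith

/-! ### The named fact -/

/-- **Cheeger–Kleiner–Naor 2011, Cor. 1.2 (of Thm. 1.1, quantitative central collapse): the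
`L¹`-distortion of the word ball of radius `r` in the discrete Heisenberg group is `≳ (log r)^δ`
for a universal `δ > 0`** (named fact, D-0014) — "`c₁({0,…,n}³, ρ) ≳ (log n)^δ`", transported
along the bi-Lipschitz identifications printed in [CKN §1.1] (`ρ ≍ d^ℍ ≍` word metric, universal
constants; `c₁` is monotone under inclusion and `{0,…,n}³` lies in a word ball of radius `≍ n`),
in the form "there exists a universal constant `δ > 0` such that `c₁(𝔅_r, d_W) ≥ (log r)^δ` [CKN]"
quoted by Naor–Young; with finite-dimensional targets `ℓ₁^N ⊂ L₁` (a weakening). Concretely: there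
are `δ > 0` and `κ > 0` such that for all `r ≥ 2`, `N`, `f : ℤ³ → (Fin N → ℝ)` and `D`, if
`d_W(g,h) ≤ Σ_k |f g k − f h k| ≤ D·d_W(g,h)` for all `g, h ∈ wordBall r`
(`d_W = cayleyGraph.dist`), then `κ·(log r)^δ ≤ D`.
[cite: CheegerKleinerNaor2011, §1.1 Thm. 1.1 and Cor. 1.2] [cite: NaorYoung2018, §1.2] -/
def CheegerKleinerNaor2011_wordBall_l1Distortion : Prop :=
  ∃ δ : ℝ, 0 < δ ∧ ∃ κ : ℝ, 0 < κ ∧ ∀ r : ℕ, 2 ≤ r →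
    ∀ (N : ℕ) (f : ℤ × ℤ × ℤ → Fin N → ℝ) (D : ℝ),
      (∀ g h : ℤ × ℤ × ℤ, g ∈ wordBall r → h ∈ wordBall r →
        (cayleyGraph.dist g h : ℝ) ≤ ∑ k, |f g k - f h k| ∧
          ∑ k, |f g k - f h k| ≤ D * (cayleyGraph.dist g h : ℝ)) →
      κ * Real.log r ^ δ ≤ D

namespace CheegerKleinerNaor2011_wordBall_l1Distortion

/-- **Scaled form**: an embedding with `s·d_W ≤ ‖f g − f h‖₁ ≤ D·s·d_W` on the word ball (`s > 0`)
has `D ≥ κ (log r)^δ` (divide `f` by `s`). [cite: CheegerKleinerNaor2011, §1.1 Cor. 1.2] -/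
theorem scaled (hF : CheegerKleinerNaor2011_wordBall_l1Distortion) :
    ∃ δ : ℝ, 0 < δ ∧ ∃ κ : ℝ, 0 < κ ∧ ∀ r : ℕ, 2 ≤ r →
      ∀ (N : ℕ) (f : ℤ × ℤ × ℤ → Fin N → ℝ) (s D : ℝ), 0 < s →
        (∀ g h : ℤ × ℤ × ℤ, g ∈ wordBall r → h ∈ wordBall r →
          s * (cayleyGraph.dist g h : ℝ) ≤ ∑ k, |f g k - f h k| ∧
            ∑ k, |f g k - f h k| ≤ D * s * (cayleyGraph.dist g h : ℝ)) →
        κ * Real.log r ^ δ ≤ D := by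
  obtain ⟨δ, hδ, κ, hκ, H⟩ := hF
  refine ⟨δ, hδ, κ, hκ, fun r hr N f s D hs hf => H r hr N (fun g k => f g k / s) D fun g h hg hh => ?_⟩
  obtain ⟨h1, h2⟩ := hf g h hg hh
  have hsum : ∑ k, |f g k / s - f h k / s| = (∑ k, |f g k - f h k|) / s := by
    rw [Finset.sum_div]
    refine Finset.sum_congr rfl fun k _ => ?_
    rw [← sub_div, abs_div, abs_of_pos hs]
  rw [hsum, le_div_iff₀ hs, div_le_iff₀ hs]
  constructor
  · simpa [mul_comm] using h1
  · calc ∑ k, |f g k - f h k| ≤ D * s * (cayleyGraph.dist g h : ℝ) := h2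
      _ = D * (cayleyGraph.dist g h : ℝ) * s := by ring

/-- **Box form (the inlined hypothesis of the route `HeisenbergSparsestCut`)**: there is `c > 0`
such that for every `n ≥ 2`, every embedding `f : ℤ³ → ℓ₁^N` with
`s·d_W(g,h) ≤ ‖f g − f h‖₁ ≤ D·s·d_W(g,h)` for all `g, h` in the box `|x|,|y| ≤ n`, `|z| ≤ n²`
(which contains the word ball of radius `n`, `mem_wordBall_bounds`) satisfies `c·(log n)^c ≤ D`
(`c = min (min δ κ) (1/2)`; the pair `1, a` gives `D ≥ 1`). The Cayley graph is written out as in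
the route. [cite: CheegerKleinerNaor2011, §1.1 Cor. 1.2] -/
theorem box (hF : CheegerKleinerNaor2011_wordBall_l1Distortion) :
    ∃ c : ℝ, 0 < c ∧ ∀ n : ℕ, 2 ≤ n → ∀ (N : ℕ) (f : ℤ × ℤ × ℤ → Fin N → ℝ) (s D : ℝ), 0 < s →
      (∀ g h : ℤ × ℤ × ℤ, |g.1| ≤ n → |g.2.1| ≤ n → |g.2.2| ≤ n ^ 2 → |h.1| ≤ n → |h.2.1| ≤ n →
        |h.2.2| ≤ n ^ 2 →
        s * ((SimpleGraph.fromRel fun a b : ℤ × ℤ × ℤ =>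
              b = (a.1 + 1, a.2.1, a.2.2) ∨ b = (a.1, a.2.1 + 1, a.2.2 + a.1)).dist g h : ℝ) ≤
            ∑ k, |f g k - f h k| ∧
          ∑ k, |f g k - f h k| ≤
            D * s * ((SimpleGraph.fromRel fun a b : ℤ × ℤ × ℤ =>
              b = (a.1 + 1, a.2.1, a.2.2) ∨ b = (a.1, a.2.1 + 1, a.2.2 + a.1)).dist g h : ℝ)) →
      c * Real.log n ^ c ≤ D := by
  obtain ⟨δ, hδ, κ, hκ, H⟩ := scaled hF
  refine ⟨min (min δ κ) (1 / 2), by positivity, fun n hn N f s D hs hf => ?_⟩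
  set c : ℝ := min (min δ κ) (1 / 2) with hc
  have hcδ : c ≤ δ := (min_le_left _ _).trans (min_le_left _ _)
  have hcκ : c ≤ κ := (min_le_left _ _).trans (min_le_right _ _)
  have hc2 : c ≤ 1 / 2 := min_le_right _ _
  have hc0 : 0 < c := by positivity
  -- the hypothesis on the box restricts to the word ball of radius `n`
  have hball : ∀ g h : ℤ × ℤ × ℤ, g ∈ wordBall n → h ∈ wordBall n →
      s * (cayleyGraph.dist g h : ℝ) ≤ ∑ k, |f g k - f h k| ∧
        ∑ k, |f g k - f h k| ≤ D * s * (cayleyGraph.dist g h : ℝ) := by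
    intro g h hg hh
    obtain ⟨g1, g2, g3⟩ := mem_wordBall_bounds hg
    obtain ⟨h1, h2, h3⟩ := mem_wordBall_bounds hh
    exact hf g h g1 g2 (by exact_mod_cast g3) h1 h2 (by exact_mod_cast h3)
  have hD : κ * Real.log n ^ δ ≤ D := H n hn N f s D hs hball
  -- `D ≥ 1` from the pair `1 = (0,0,0)`, `a = (1,0,0)` at word distance `1`
  have hD1 : 1 ≤ D := by
    obtain ⟨h1, h2⟩ := hball (0, 0, 0) (1, 0, 0) (zero_mem_wordBall n)
      (genA_mem_wordBall (by omega))
    rw [dist_zero_genA] at h1 h2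
    simp only [Nat.cast_one, mul_one] at h1 h2
    nlinarith
  have hlog0 : 0 ≤ Real.log n := Real.log_nonneg (by exact_mod_cast (by omega : 1 ≤ n))
  by_cases hlog : 1 ≤ Real.log n
  · -- `c (log n)^c ≤ κ (log n)^δ ≤ D`
    calc c * Real.log n ^ c ≤ κ * Real.log n ^ δ := by
          apply mul_le_mul hcκ (Real.rpow_le_rpow_of_exponent_le hlog hcδ)
            (Real.rpow_nonneg hlog0 _) hκ.le
      _ ≤ D := hD
  · -- `log n < 1`: `c (log n)^c ≤ c ≤ 1/2 < 1 ≤ D`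
    have h1 : Real.log n ^ c ≤ 1 := Real.rpow_le_one hlog0 (le_of_not_ge hlog) hc0.le
    calc c * Real.log n ^ c ≤ c * 1 := mul_le_mul_of_nonneg_left h1 hc0.le
      _ ≤ 1 := by linarith
      _ ≤ D := hD1

end CheegerKleinerNaor2011_wordBall_l1Distortion

end Literature.Geometry.MetricEmbeddings

end
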